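import Literature.Analysis.FluidPDE.CoordDerivatives
import Literature.Analysis.FluidPDE.NSVorticityEnergy
import Summits.NavierStokesRegularity.NavierStokesRegularity.Theorems.TypeICertificateLadderTargetStrainCubePointwise
import HarnessLib

/-!
# Crux `Target` = `TypeICertificateLadder.NoTypeIBlowup` (stmt-NavierStokesRegularity-1217), line
# `depletion-ladder`: COORDINATE CALCULUS OF THE STRAIN AND OF ITS REGULARISED MODULUS

`--supports stmt-NavierStokesRegularity-1217` (second file of the seat's proof of the depletion
constant `κ = (√3+√6)/9 < 1/2` in the Tao-slice class, hence RUNG TWO of the amplitude ladder).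

For a smooth field `v : ℝ³ → ℝ³` write `aᵢⱼ = ∂ⱼvᵢ` (`pderiv j (fun y => v y i)`), the strain
`sᵢⱼ = ½(aᵢⱼ + aⱼᵢ)`, `q = Σᵢⱼ sᵢⱼ² = |S|²_F`, and for `ε > 0` the REGULARISED MODULUS
`N = √(q + ε²) − ε` (smooth, `0 ≤ N ≤ √q`, `√q − N ≤ ε`, `|∂ₗN|² ≤ Σᵢⱼ (∂ₗ sᵢⱼ)²`). This file
collects the pointwise calculus used by the cube interpolation
`∫|S|³ ≤ ‖v‖_∞ (½‖Δv‖₂‖S‖₂ + ‖S‖₂‖∇S‖₂)` of the sequel file: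

* `abs_grad_le_norm_fderiv`, `abs_pderiv_grad_le` — `|∂ⱼvᵢ| ≤ ‖Dv‖`, `|∂ₖ∂ⱼvᵢ| ≤ ‖D²v‖`;
* `sum_pderiv_sym_eq_half_laplacian` — **`Σⱼ ∂ⱼ sᵢⱼ = ½ (Δv)ᵢ` for divergence-free `v`**
  (`Σⱼ ∂ⱼ∂ᵢvⱼ = ∂ᵢ div v = 0`, Schwarz);
* `regMod_*` — the properties of `N` listed above, for any smooth family `sᵢⱼ`.

WHAT THIS IS NOT: no integral statement; pointwise calculus only. [folklore]
-/

noncomputable section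

open Finset
open scoped Laplacian ContDiff

namespace Summit.NavierStokesRegularity.NavierStokesRegularity.Theorems.DepletionLadder.StrainCube

-- the problem directory repeats the summit name (`NavierStokesRegularity/NavierStokesRegularity`)
set_option linter.dupNamespace false

open Literature.Analysis.FluidPDE

local notation "E3" => EuclideanSpace ℝ (Fin 3)

variable {v : E3 → E3}

/-! ## Components and their coordinate derivatives -/

/-- Components of a smooth field are smooth. [folklore] -/
theorem contDiff_apply_of (hv : ContDiff ℝ ∞ v) (i : Fin 3) : ContDiff ℝ ∞ fun y => v y i :=
  contDiff_euclidean.1 hv i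

/-- `aᵢⱼ = ∂ⱼvᵢ` is smooth. [folklore] -/
theorem contDiff_grad (hv : ContDiff ℝ ∞ v) (i j : Fin 3) :
    ContDiff ℝ ∞ (pderiv j fun y => v y i) :=
  contDiff_pderiv (contDiff_apply_of hv i) j

/-- `∂ⱼvᵢ (x) = (Dv(x) eⱼ)ᵢ`. [folklore] -/
theorem grad_eq_fderiv_apply (hv : ContDiff ℝ ∞ v) (i j : Fin 3) (x : E3) :
    pderiv j (fun y => v y i) x = fderiv ℝ v x (stdVec j) i := by
  rw [pderiv_apply, euclidean_fderiv_apply_comp ((hv.differentiable (by simp)) x)]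

/-- `|∂ⱼvᵢ (x)| ≤ ‖Dv(x)‖`. [folklore] -/
theorem abs_grad_le_norm_fderiv (hv : ContDiff ℝ ∞ v) (i j : Fin 3) (x : E3) :
    |pderiv j (fun y => v y i) x| ≤ ‖fderiv ℝ v x‖ := by
  rw [grad_eq_fderiv_apply hv]
  calc |fderiv ℝ v x (stdVec j) i| = ‖fderiv ℝ v x (stdVec j) i‖ := (Real.norm_eq_abs _).symm
    _ ≤ ‖fderiv ℝ v x (stdVec j)‖ := PiLp.norm_apply_le _ _
    _ ≤ ‖fderiv ℝ v x‖ * ‖(stdVec j : E3)‖ := (fderiv ℝ v x).le_opNorm _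
    _ = ‖fderiv ℝ v x‖ := by simp [stdVec]

/-- `‖Dv(x)‖ = ‖D¹v(x)‖` (iterated derivative of order one). [folklore] -/
theorem norm_fderiv_eq_norm_iteratedFDeriv_one (x : E3) :
    ‖fderiv ℝ v x‖ = ‖iteratedFDeriv ℝ 1 v x‖ := by
  rw [← norm_iteratedFDeriv_fderiv, norm_iteratedFDeriv_zero]

/-- `|∂ₖ∂ⱼvᵢ (x)| ≤ ‖D²v(x)‖`. [folklore] -/
theorem abs_pderiv_grad_le (hv : ContDiff ℝ ∞ v) (i j k : Fin 3) (x : E3) :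
    |pderiv k (pderiv j fun y => v y i) x| ≤ ‖iteratedFDeriv ℝ 2 v x‖ := by
  have h1 : pderiv k (pderiv j fun y => v y i) x = ipderiv ![k, j] (fun y => v y i) x := by
    simp [ipderiv_succ]
  rw [h1]
  exact (abs_ipderiv_le_norm_iteratedFDeriv (contDiff_apply_of hv i) _ x).trans
    (norm_iteratedFDeriv_apply_le hv i 2 x)

/-- `|vᵢ(x)| ≤ ‖v(x)‖`. [folklore] -/
theorem abs_apply_le_norm (x : E3) (i : Fin 3) : |v x i| ≤ ‖v x‖ := by
  rw [← Real.norm_eq_abs]; exact PiLp.norm_apply_le _ _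

/-- `‖w‖² = Σᵢ wᵢ²` on `ℝ³`. [folklore] -/
theorem norm_sq_eq_sum_sq (w : E3) : ‖w‖ ^ 2 = ∑ i, w i ^ 2 := by
  rw [EuclideanSpace.real_norm_sq_eq]

/-! ## The strain rows are half-Laplacians: `Σⱼ ∂ⱼ sᵢⱼ = ½ (Δv)ᵢ` -/

/-- `Σⱼ ∂ⱼ∂ᵢ vⱼ = 0` for a smooth divergence-free field (`= ∂ᵢ div v`). [folklore] -/
theorem sum_pderiv_pderiv_swap_eq_zero (hv : ContDiff ℝ ∞ v) (hdiv : VectorCalculus.IsDivFree v)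
    (i : Fin 3) (x : E3) : ∑ j, pderiv j (pderiv i fun y => v y j) x = 0 := by
  have hvj : ∀ j, ContDiff ℝ ∞ fun y => v y j := contDiff_apply_of hv
  have h1 : ∀ j, pderiv j (pderiv i fun y => v y j) x = pderiv i (pderiv j fun y => v y j) x :=
    fun j => by rw [pderiv_comm (hvj j)]
  simp only [h1]
  have h2 : ∑ j, pderiv i (pderiv j fun y => v y j) x =
      pderiv i (fun y => ∑ j, pderiv j (fun z => v z j) y) x := by
    rw [pderiv_sum (f := fun j y => pderiv j (fun z => v z j) y) _
      (fun j _ => (contDiff_grad hv j j).differentiable (by simp))]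
  rw [h2]
  have h3 : (fun y => ∑ j, pderiv j (fun z => v z j) y) = fun _ => (0 : ℝ) :=
    funext fun y => hdiv.sum_pderiv_comp_eq_zero (hv.differentiable (by simp)) y
  rw [h3, pderiv_const]

/-- **`Σⱼ ∂ⱼ sᵢⱼ = ½ (Δv)ᵢ`** for a smooth divergence-free field, `sᵢⱼ = ½(∂ⱼvᵢ + ∂ᵢvⱼ)`:
the divergence of the rows of the strain is half the Laplacian (`Σⱼ∂ⱼ∂ⱼvᵢ = (Δv)ᵢ`,
`Σⱼ∂ⱼ∂ᵢvⱼ = ∂ᵢ div v = 0`). [folklore] -/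
theorem sum_pderiv_sym_eq_half_laplacian (hv : ContDiff ℝ ∞ v) (hdiv : VectorCalculus.IsDivFree v)
    (i : Fin 3) (x : E3) :
    ∑ j, pderiv j (fun y => (pderiv j (fun z => v z i) y + pderiv i (fun z => v z j) y) / 2) x =
      (1 / 2) * (Δ v) x i := by
  have hd : ∀ i j, Differentiable ℝ (pderiv j fun z => v z i) :=
    fun i j => (contDiff_grad hv i j).differentiable (by simp)
  have h1 : ∀ j, pderiv j (fun y => (pderiv j (fun z => v z i) y + pderiv i (fun z => v z j) y) / 2) x
      = (pderiv j (pderiv j fun z => v z i) x + pderiv j (pderiv i fun z => v z j) x) / 2 := by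
    intro j
    have hF : HasFDerivAt (fun y => (pderiv j (fun z => v z i) y + pderiv i (fun z => v z j) y) / 2)
        ((1 / 2 : ℝ) • (fderiv ℝ (pderiv j fun z => v z i) x + fderiv ℝ (pderiv i fun z => v z j) x)) x := by
      have h := ((hd i j x).hasFDerivAt.add (hd j i x).hasFDerivAt).const_mul (1 / 2 : ℝ)
      have hfun : (fun y => (pderiv j (fun z => v z i) y + pderiv i (fun z => v z j) y) / 2) =
          fun y => (1 / 2 : ℝ) * (pderiv j (fun z => v z i) y + pderiv i (fun z => v z j) y) := by
        funext y; ring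
      rw [hfun]; exact h
    rw [pderiv_apply, hF.fderiv]
    change (1 / 2 : ℝ) * (fderiv ℝ (pderiv j fun z => v z i) x (stdVec j) +
      fderiv ℝ (pderiv i fun z => v z j) x (stdVec j)) = _
    simp only [← pderiv_apply]
    ring
  simp only [h1]
  rw [← Finset.sum_div, Finset.sum_add_distrib, sum_pderiv_pderiv_swap_eq_zero hv hdiv i x, add_zero,
    laplacian_apply_comp (hv.of_le (by norm_cast)) x i]
  ring

/-! ## The regularised modulus `N = √(q + ε²) − ε` of a smooth family `sᵢⱼ` -/

section RegMod

variable {s : Fin 3 → Fin 3 → E3 → ℝ} {ε : ℝ}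

/-- `q = Σᵢⱼ sᵢⱼ²` is smooth. [folklore] -/
theorem contDiff_sumSq (hs : ∀ i j, ContDiff ℝ ∞ (s i j)) :
    ContDiff ℝ ∞ fun x => ∑ i, ∑ j, s i j x ^ 2 :=
  ContDiff.sum fun i _ => ContDiff.sum fun j _ => (hs i j).pow 2

/-- `0 ≤ q`. [folklore] -/
theorem sumSq_nonneg (x : E3) : 0 ≤ ∑ i, ∑ j, s i j x ^ 2 :=
  sum_nonneg fun _ _ => sum_nonneg fun _ _ => sq_nonneg _

/-- `N = √(q + ε²) − ε` is smooth for `ε > 0`. [folklore] -/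
theorem contDiff_regMod (hs : ∀ i j, ContDiff ℝ ∞ (s i j)) (hε : 0 < ε) :
    ContDiff ℝ ∞ fun x => Real.sqrt (∑ i, ∑ j, s i j x ^ 2 + ε ^ 2) - ε := by
  refine ContDiff.sub ?_ contDiff_const
  refine ((contDiff_sumSq hs).add contDiff_const).sqrt fun x => ?_
  have := sumSq_nonneg (s := s) x
  positivity

/-- `0 ≤ N`. [folklore] -/
theorem regMod_nonneg (hε : 0 < ε) (x : E3) :
    0 ≤ Real.sqrt (∑ i, ∑ j, s i j x ^ 2 + ε ^ 2) - ε := by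
  have h : ε ≤ Real.sqrt (∑ i, ∑ j, s i j x ^ 2 + ε ^ 2) := by
    calc ε = Real.sqrt (ε ^ 2) := (Real.sqrt_sq hε.le).symm
      _ ≤ Real.sqrt (∑ i, ∑ j, s i j x ^ 2 + ε ^ 2) :=
          Real.sqrt_le_sqrt (by linarith [sumSq_nonneg (s := s) x])
  linarith

/-- `N ≤ √q`. [folklore] -/
theorem regMod_le_sqrt (hε : 0 < ε) (x : E3) :
    Real.sqrt (∑ i, ∑ j, s i j x ^ 2 + ε ^ 2) - ε ≤ Real.sqrt (∑ i, ∑ j, s i j x ^ 2) := by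
  set q := ∑ i, ∑ j, s i j x ^ 2 with hq
  have hq0 : 0 ≤ q := sumSq_nonneg (s := s) x
  have h : Real.sqrt (q + ε ^ 2) ≤ Real.sqrt q + ε := by
    have h1 : q + ε ^ 2 ≤ (Real.sqrt q + ε) ^ 2 := by
      nlinarith [Real.sq_sqrt hq0, Real.sqrt_nonneg q, hε.le]
    calc Real.sqrt (q + ε ^ 2) ≤ Real.sqrt ((Real.sqrt q + ε) ^ 2) := Real.sqrt_le_sqrt h1
      _ = Real.sqrt q + ε := Real.sqrt_sq (by positivity)
  linarith

/-- `√q − N ≤ ε`. [folklore] -/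
theorem sqrt_sub_regMod_le (x : E3) :
    Real.sqrt (∑ i, ∑ j, s i j x ^ 2) - (Real.sqrt (∑ i, ∑ j, s i j x ^ 2 + ε ^ 2) - ε) ≤ ε := by
  have h : Real.sqrt (∑ i, ∑ j, s i j x ^ 2) ≤ Real.sqrt (∑ i, ∑ j, s i j x ^ 2 + ε ^ 2) :=
    Real.sqrt_le_sqrt (by nlinarith)
  linarith

/-- `N² ≤ q`. [folklore] -/
theorem regMod_sq_le (hε : 0 < ε) (x : E3) :
    (Real.sqrt (∑ i, ∑ j, s i j x ^ 2 + ε ^ 2) - ε) ^ 2 ≤ ∑ i, ∑ j, s i j x ^ 2 := by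
  have h0 := regMod_nonneg (s := s) hε x
  have h1 := regMod_le_sqrt (s := s) hε x
  have hq0 : 0 ≤ ∑ i, ∑ j, s i j x ^ 2 := sumSq_nonneg (s := s) x
  calc (Real.sqrt (∑ i, ∑ j, s i j x ^ 2 + ε ^ 2) - ε) ^ 2
      ≤ (Real.sqrt (∑ i, ∑ j, s i j x ^ 2)) ^ 2 := pow_le_pow_left₀ h0 h1 2
    _ = ∑ i, ∑ j, s i j x ^ 2 := Real.sq_sqrt hq0

/-- `∂ₗ q = Σᵢⱼ 2 sᵢⱼ ∂ₗsᵢⱼ`. [folklore] -/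
theorem pderiv_sumSq (hs : ∀ i j, ContDiff ℝ ∞ (s i j)) (l : Fin 3) (x : E3) :
    pderiv l (fun y => ∑ i, ∑ j, s i j y ^ 2) x = ∑ i, ∑ j, 2 * s i j x * pderiv l (s i j) x := by
  have hd : ∀ i j, Differentiable ℝ (s i j) := fun i j => (hs i j).differentiable (by simp)
  rw [pderiv_sum (f := fun i y => ∑ j, s i j y ^ 2) _
    (fun i _ => by fun_prop)]
  refine Finset.sum_congr rfl fun i _ => ?_
  rw [pderiv_sum (f := fun j y => s i j y ^ 2) _ (fun j _ => (hd i j).pow 2)]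
  refine Finset.sum_congr rfl fun j _ => ?_
  have := congrFun (pderiv_pow (hd i j) 1 l) x
  simp only [pow_one] at this
  rw [this]; norm_num

/-- **`∂ₗ N = (Σᵢⱼ sᵢⱼ ∂ₗsᵢⱼ) / √(q + ε²)`** (chain rule for `√(q + ε²) − ε`). [folklore] -/
theorem pderiv_regMod (hs : ∀ i j, ContDiff ℝ ∞ (s i j)) (hε : 0 < ε) (l : Fin 3) (x : E3) :
    pderiv l (fun y => Real.sqrt (∑ i, ∑ j, s i j y ^ 2 + ε ^ 2) - ε) x =
      (∑ i, ∑ j, s i j x * pderiv l (s i j) x) / Real.sqrt (∑ i, ∑ j, s i j x ^ 2 + ε ^ 2) := by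
  set q : E3 → ℝ := fun y => ∑ i, ∑ j, s i j y ^ 2 with hqdef
  have hqd : Differentiable ℝ q := (contDiff_sumSq hs).differentiable (by simp)
  have hpos : ∀ y, 0 < q y + ε ^ 2 := fun y => by
    have := sumSq_nonneg (s := s) y; simp only [hqdef]; positivity
  have hF : HasFDerivAt (fun y => q y + ε ^ 2) (fderiv ℝ q x) x := by
    simpa using (hqd x).hasFDerivAt.add_const (ε ^ 2)
  have hS : HasFDerivAt (fun y => Real.sqrt (q y + ε ^ 2) - ε)
      ((1 / (2 * Real.sqrt (q x + ε ^ 2))) • fderiv ℝ q x) x := by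
    simpa using (hF.sqrt (hpos x).ne').sub_const ε
  rw [pderiv_apply, hS.fderiv]
  change (1 / (2 * Real.sqrt (q x + ε ^ 2))) * fderiv ℝ q x (stdVec l) = _
  rw [← pderiv_apply, pderiv_sumSq hs l x]
  have h2 : ∑ i, ∑ j, 2 * s i j x * pderiv l (s i j) x = 2 * ∑ i, ∑ j, s i j x * pderiv l (s i j) x := by
    rw [Finset.mul_sum]; refine Finset.sum_congr rfl fun i _ => ?_
    rw [Finset.mul_sum]; refine Finset.sum_congr rfl fun j _ => ?_; ring
  rw [h2]
  have hsq : Real.sqrt (q x + ε ^ 2) ≠ 0 := (Real.sqrt_pos.2 (hpos x)).ne'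
  have hq' : Real.sqrt (∑ i, ∑ j, s i j x ^ 2 + ε ^ 2) = Real.sqrt (q x + ε ^ 2) := rfl
  rw [hq']
  field_simp

/-- **`(∂ₗ N)² ≤ Σᵢⱼ (∂ₗ sᵢⱼ)²`** (Cauchy–Schwarz and `q ≤ q + ε²`). [folklore] -/
theorem sq_pderiv_regMod_le (hs : ∀ i j, ContDiff ℝ ∞ (s i j)) (hε : 0 < ε) (l : Fin 3) (x : E3) :
    pderiv l (fun y => Real.sqrt (∑ i, ∑ j, s i j y ^ 2 + ε ^ 2) - ε) x ^ 2 ≤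
      ∑ i, ∑ j, pderiv l (s i j) x ^ 2 := by
  rw [pderiv_regMod hs hε l x, div_pow]
  set q := ∑ i, ∑ j, s i j x ^ 2 with hq
  set D := ∑ i, ∑ j, pderiv l (s i j) x ^ 2 with hD
  have hq0 : 0 ≤ q := sumSq_nonneg (s := s) x
  have hD0 : 0 ≤ D := sumSq_nonneg (s := fun i j y => pderiv l (s i j) y) x
  have hpos : 0 < q + ε ^ 2 := by positivity
  rw [Real.sq_sqrt hpos.le, div_le_iff₀ hpos]
  have hCS := sq_sum_sum_mul_le (fun i j => s i j x) (fun i j => pderiv l (s i j) x)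
  calc (∑ i, ∑ j, s i j x * pderiv l (s i j) x) ^ 2 ≤ q * D := hCS
    _ ≤ D * (q + ε ^ 2) := by nlinarith

/-- `|∂ₗN| ≤ √(Σᵢⱼ (∂ₗ sᵢⱼ)²)`. [folklore] -/
theorem abs_pderiv_regMod_le (hs : ∀ i j, ContDiff ℝ ∞ (s i j)) (hε : 0 < ε) (l : Fin 3) (x : E3) :
    |pderiv l (fun y => Real.sqrt (∑ i, ∑ j, s i j y ^ 2 + ε ^ 2) - ε) x| ≤
      Real.sqrt (∑ i, ∑ j, pderiv l (s i j) x ^ 2) := by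
  rw [← Real.sqrt_sq_eq_abs]
  exact Real.sqrt_le_sqrt (sq_pderiv_regMod_le hs hε l x)

end RegMod

end Summit.NavierStokesRegularity.NavierStokesRegularity.Theorems.DepletionLadder.StrainCube

end
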